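import Literature.AlgebraicGeometry.Motives.MixedHodgeExtensionHomTensorProd
import HarnessLib

/-!
# `Ext(A₁ ⊕ A₂, B₁ ⊕ B₂)` as a `2 × 2` matrix of extension classes

Mac Lane, *Homology*, Ch. III Thm. 2.1: `Ext` is an additive bifunctor (`(α₁ + α₂)_* = α₁_* + α₂_*`,
`(γ₁ + γ₂)^* = γ₁^* + γ₂^*`), whence the natural isomorphisms
"`Ext(A, C₁ ⊕ C₂) ≅ Ext(A, C₁) ⊕ Ext(A, C₂)`, `Ext(C₁ ⊕ C₂, A) ≅ Ext(C₁, A) ⊕ Ext(C₂, A)`" (p. 72, by the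
argument (I.6.5) for additive functors). The tree has both one-variable decompositions for mixed Hodge
structures (`Ext.prodEquivLeft`, `Ext.prodEquivRight` of `MixedHodgeExtensionBiproduct`) and the direct sum
of classes `Ext.prodW x₁ x₂ = [E₁ ⊕ E₂]` (`MixedHodgeExtensionHomTensorProd`). Iterating gives the
**four-fold decomposition**

  `Ext(A₁ ⊕ A₂, B₁ ⊕ B₂) ≃ (Ext(A₁, B₁) × Ext(A₁, B₂)) × (Ext(A₂, B₁) × Ext(A₂, B₂))`,
  `x ↦ ((π₁_* ι₁^* x, π₂_* ι₁^* x), (π₁_* ι₂^* x, π₂_* ι₂^* x))`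

(`Ext.prodEquivFour`), with inverse `(x_{ij}) ↦ Σ_{i,j} (ι_j)_* π_i^* x_{ij}`; in these coordinates the direct
sum `x₁ ⊕ x₂` is the DIAGONAL matrix `((x₁, 0), (0, x₂))` (`prodEquivFour_prodW`), so a class over
`A₁ ⊕ A₂` with values in `B₁ ⊕ B₂` is a direct sum of classes iff its off-diagonal coordinates vanish
(`exists_eq_prodW_iff`); the decomposition is additive, natural for `f₁ ⊕ f₂` and `g₁ ⊕ g₂`
(entrywise `g_j_* f_i^*`), compatible with Brylinski–Zucker's `J⁰W₀Hom` (`JHomW.prodEquivFour`), and on an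
extension `E` the entries are the classes of `π_j_* ι_i^* E` (`prodEquivFour_mkOfW`), so `E` splits iff
its four corner extensions split.

All statements proved; definitions with bodies; no named facts.

## References

* [MacLane1963Homology] S. Mac Lane, Homology, Grundlehren 114, Springer (1963), Ch. III Thm. 2.1 and
  the isomorphisms following it (p. 72); Ch. I (6.4)–(6.5); Ch. III (2.3), Lemmas 1.2, 1.4, 1.6.
* [Carlson1980] J. A. Carlson, Extensions of mixed Hodge structures (1980), §2(b) Prop. 1.
* [BrylinskiZucker1998] J.-L. Brylinski, S. Zucker, An overview of recent advances in Hodge theory,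
  Prop. 5.22.
-/

open scoped TensorProduct

noncomputable section

namespace Literature.AlgebraicGeometry.Motives

namespace MixedHodgeStructure

universe u₁ u₂ v₁ v₂ u₁' u₂' v₁' v₂' w w'

variable {V₁ : Type u₁} [AddCommGroup V₁] [Module ℚ V₁] {V₂ : Type u₂} [AddCommGroup V₂] [Module ℚ V₂]
variable {W₁ : Type v₁} [AddCommGroup W₁] [Module ℚ W₁] {W₂ : Type v₂} [AddCommGroup W₂] [Module ℚ W₂]

/-! ### §1 `J⁰W₀Hom(A₁ ⊕ A₂, B₁ ⊕ B₂)` as a matrix -/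

namespace JHomW

variable (A₁ : MixedHodgeStructure V₁) (A₂ : MixedHodgeStructure V₂) (B₁ : MixedHodgeStructure W₁)
  (B₂ : MixedHodgeStructure W₂)

/-- **`J⁰W₀Hom(A₁ ⊕ A₂, B₁ ⊕ B₂) ≅ ⊕_{i,j} J⁰W₀Hom(A_i, B_j)`**, `c ↦ ((π₁_* ι₁^* c, π₂_* ι₁^* c),
(π₁_* ι₂^* c, π₂_* ι₂^* c))` (Mac Lane (I.6.5) for the additive bifunctor `J⁰W₀Hom`).
[cite: MacLane1963Homology, Ch. I (6.5)] -/
def prodEquivFour :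
    JHomW (A₁.prod A₂) (B₁.prod B₂) ≃ₗ[ℚ] (JHomW A₁ B₁ × JHomW A₁ B₂) × (JHomW A₂ B₁ × JHomW A₂ B₂) :=
  (prodEquivLeft A₁ A₂ (B₁.prod B₂)).trans
    (LinearEquiv.prodCongr (prodEquivRight A₁ B₁ B₂) (prodEquivRight A₂ B₁ B₂))

/-- The entries of `prodEquivFour c` are `π_j_* ι_i^* c`. [cite: MacLane1963Homology, Ch. I (6.5)] -/
@[simp]
theorem prodEquivFour_apply (c : JHomW (A₁.prod A₂) (B₁.prod B₂)) :
    prodEquivFour A₁ A₂ B₁ B₂ c =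
      ((postcomp A₁ (Hom.fst B₁ B₂) (precomp (B₁.prod B₂) (Hom.inl A₁ A₂) c),
          postcomp A₁ (Hom.snd B₁ B₂) (precomp (B₁.prod B₂) (Hom.inl A₁ A₂) c)),
        (postcomp A₂ (Hom.fst B₁ B₂) (precomp (B₁.prod B₂) (Hom.inr A₁ A₂) c),
          postcomp A₂ (Hom.snd B₁ B₂) (precomp (B₁.prod B₂) (Hom.inr A₁ A₂) c))) := rfl

/-- `prodEquivFour⁻¹ (c_{ij}) = Σ π_i^* (ι_j)_* c_{ij}`. [cite: MacLane1963Homology, Ch. I (6.5)] -/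
theorem prodEquivFour_symm_apply (c : (JHomW A₁ B₁ × JHomW A₁ B₂) × (JHomW A₂ B₁ × JHomW A₂ B₂)) :
    (prodEquivFour A₁ A₂ B₁ B₂).symm c =
      precomp (B₁.prod B₂) (Hom.fst A₁ A₂)
          (postcomp A₁ (Hom.inl B₁ B₂) c.1.1 + postcomp A₁ (Hom.inr B₁ B₂) c.1.2) +
        precomp (B₁.prod B₂) (Hom.snd A₁ A₂)
          (postcomp A₂ (Hom.inl B₁ B₂) c.2.1 + postcomp A₂ (Hom.inr B₁ B₂) c.2.2) := by
  obtain ⟨⟨c₁₁, c₁₂⟩, ⟨c₂₁, c₂₂⟩⟩ := c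
  rfl

end JHomW

/-! ### §2 `Ext(A₁ ⊕ A₂, B₁ ⊕ B₂)` as a matrix -/

namespace Ext

section Four

variable (A₁ : MixedHodgeStructure V₁) (A₂ : MixedHodgeStructure V₂) (B₁ : MixedHodgeStructure W₁)
  (B₂ : MixedHodgeStructure W₂)

/-- **`Ext(A₁ ⊕ A₂, B₁ ⊕ B₂) ≃ (Ext(A₁, B₁) × Ext(A₁, B₂)) × (Ext(A₂, B₁) × Ext(A₂, B₂))`**,
`x ↦ ((π₁_* ι₁^* x, π₂_* ι₁^* x), (π₁_* ι₂^* x, π₂_* ι₂^* x))`: Mac Lane's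
"`Ext(C₁ ⊕ C₂, A) ≅ Ext(C₁, A) ⊕ Ext(C₂, A)`" followed by "`Ext(C, A₁ ⊕ A₂) ≅ Ext(C, A₁) ⊕ Ext(C, A₂)`" in
each summand (Thm. 2.1 and (I.6.5)). [cite: MacLane1963Homology, Ch. III Thm. 2.1] -/
def prodEquivFour :
    Ext (A₁.prod A₂) (B₁.prod B₂) ≃ (Ext A₁ B₁ × Ext A₁ B₂) × (Ext A₂ B₁ × Ext A₂ B₂) :=
  (prodEquivLeft A₁ A₂ (B₁.prod B₂)).trans
    (Equiv.prodCongr (prodEquivRight A₁ B₁ B₂) (prodEquivRight A₂ B₁ B₂))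

/-- The entries of `prodEquivFour x` are `π_j_* ι_i^* x`. [cite: MacLane1963Homology, Ch. III Thm. 2.1] -/
@[simp]
theorem prodEquivFour_apply (x : Ext (A₁.prod A₂) (B₁.prod B₂)) :
    prodEquivFour A₁ A₂ B₁ B₂ x =
      ((pushoutMapW (Hom.fst B₁ B₂) (pullbackMapW (Hom.inl A₁ A₂) x),
          pushoutMapW (Hom.snd B₁ B₂) (pullbackMapW (Hom.inl A₁ A₂) x)),
        (pushoutMapW (Hom.fst B₁ B₂) (pullbackMapW (Hom.inr A₁ A₂) x),
          pushoutMapW (Hom.snd B₁ B₂) (pullbackMapW (Hom.inr A₁ A₂) x))) := rfl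

/-- `prodEquivFour⁻¹ (x_{ij}) = π₁^* (ι₁_* x₁₁ + ι₂_* x₁₂) + π₂^* (ι₁_* x₂₁ + ι₂_* x₂₂)` (Baer sums).
[cite: MacLane1963Homology, Ch. III Thm. 2.1] -/
theorem prodEquivFour_symm_apply (m : (Ext A₁ B₁ × Ext A₁ B₂) × (Ext A₂ B₁ × Ext A₂ B₂)) :
    (prodEquivFour A₁ A₂ B₁ B₂).symm m =
      addW (pullbackMapW (Hom.fst A₁ A₂)
          (addW (pushoutMapW (Hom.inl B₁ B₂) m.1.1) (pushoutMapW (Hom.inr B₁ B₂) m.1.2)))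
        (pullbackMapW (Hom.snd A₁ A₂)
          (addW (pushoutMapW (Hom.inl B₁ B₂) m.2.1) (pushoutMapW (Hom.inr B₁ B₂) m.2.2))) := by
  obtain ⟨⟨m₁₁, m₁₂⟩, ⟨m₂₁, m₂₂⟩⟩ := m
  rfl

/-- The inverse as the sum of the four classes `(ι_j)_* π_i^* x_{ij}`.
[cite: MacLane1963Homology, Ch. III Thm. 2.1] -/
theorem prodEquivFour_symm_apply_eq_sum (m : (Ext A₁ B₁ × Ext A₁ B₂) × (Ext A₂ B₁ × Ext A₂ B₂)) :
    (prodEquivFour A₁ A₂ B₁ B₂).symm m =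
      addW
        (addW (pushoutMapW (Hom.inl B₁ B₂) (pullbackMapW (Hom.fst A₁ A₂) m.1.1))
          (pushoutMapW (Hom.inr B₁ B₂) (pullbackMapW (Hom.fst A₁ A₂) m.1.2)))
        (addW (pushoutMapW (Hom.inl B₁ B₂) (pullbackMapW (Hom.snd A₁ A₂) m.2.1))
          (pushoutMapW (Hom.inr B₁ B₂) (pullbackMapW (Hom.snd A₁ A₂) m.2.2))) := by
  rw [prodEquivFour_symm_apply, pullbackMapW_addW, pullbackMapW_addW]
  simp only [← pushoutMapW_pullbackMapW]

variable {A₁ A₂ B₁ B₂}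

/-- **Two classes in `Ext(A₁ ⊕ A₂, B₁ ⊕ B₂)` are equal iff their four entries `π_j_* ι_i^*` agree.**
[cite: MacLane1963Homology, Ch. III Thm. 2.1] -/
theorem eq_iff_prodEquivFour (x y : Ext (A₁.prod A₂) (B₁.prod B₂)) :
    x = y ↔ prodEquivFour A₁ A₂ B₁ B₂ x = prodEquivFour A₁ A₂ B₁ B₂ y :=
  (prodEquivFour A₁ A₂ B₁ B₂).injective.eq_iff.symm

/-- `prodEquivFour` is additive (entrywise Baer sums). [cite: MacLane1963Homology, Ch. III Thm. 2.1] -/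
theorem prodEquivFour_addW (x y : Ext (A₁.prod A₂) (B₁.prod B₂)) :
    prodEquivFour A₁ A₂ B₁ B₂ (addW x y) =
      ((addW (prodEquivFour A₁ A₂ B₁ B₂ x).1.1 (prodEquivFour A₁ A₂ B₁ B₂ y).1.1,
          addW (prodEquivFour A₁ A₂ B₁ B₂ x).1.2 (prodEquivFour A₁ A₂ B₁ B₂ y).1.2),
        (addW (prodEquivFour A₁ A₂ B₁ B₂ x).2.1 (prodEquivFour A₁ A₂ B₁ B₂ y).2.1,
          addW (prodEquivFour A₁ A₂ B₁ B₂ x).2.2 (prodEquivFour A₁ A₂ B₁ B₂ y).2.2)) := by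
  simp only [prodEquivFour_apply, pullbackMapW_addW, pushoutMapW_addW]

/-- `prodEquivFour 0 = 0`. [cite: MacLane1963Homology, Ch. III Thm. 2.1] -/
theorem prodEquivFour_zeroW :
    prodEquivFour A₁ A₂ B₁ B₂ zeroW = ((zeroW, zeroW), (zeroW, zeroW)) := by
  simp only [prodEquivFour_apply, pullbackMapW_zeroW, pushoutMapW_zeroW]

/-- `prodEquivFour (-x) = -(prodEquivFour x)` entrywise. [cite: MacLane1963Homology, Ch. III Thm. 2.1] -/
theorem prodEquivFour_negW (x : Ext (A₁.prod A₂) (B₁.prod B₂)) :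
    prodEquivFour A₁ A₂ B₁ B₂ (negW x) =
      ((negW (prodEquivFour A₁ A₂ B₁ B₂ x).1.1, negW (prodEquivFour A₁ A₂ B₁ B₂ x).1.2),
        (negW (prodEquivFour A₁ A₂ B₁ B₂ x).2.1, negW (prodEquivFour A₁ A₂ B₁ B₂ x).2.2)) := by
  simp only [prodEquivFour_apply, pullbackMapW_negW, pushoutMapW_negW]

/-- The inverse is additive. [cite: MacLane1963Homology, Ch. III Thm. 2.1] -/
theorem prodEquivFour_symm_addW (m m' : (Ext A₁ B₁ × Ext A₁ B₂) × (Ext A₂ B₁ × Ext A₂ B₂)) :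
    (prodEquivFour A₁ A₂ B₁ B₂).symm
        (((addW m.1.1 m'.1.1, addW m.1.2 m'.1.2), (addW m.2.1 m'.2.1, addW m.2.2 m'.2.2))) =
      addW ((prodEquivFour A₁ A₂ B₁ B₂).symm m) ((prodEquivFour A₁ A₂ B₁ B₂).symm m') := by
  apply (prodEquivFour A₁ A₂ B₁ B₂).injective
  rw [Equiv.apply_symm_apply, prodEquivFour_addW, Equiv.apply_symm_apply, Equiv.apply_symm_apply]

/-- **A class is split iff its four entries are split.** [cite: MacLane1963Homology, Ch. III Thm. 2.1] -/
theorem eq_zeroW_iff_prodEquivFour (x : Ext (A₁.prod A₂) (B₁.prod B₂)) :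
    x = zeroW ↔
      (pushoutMapW (Hom.fst B₁ B₂) (pullbackMapW (Hom.inl A₁ A₂) x) = zeroW ∧
          pushoutMapW (Hom.snd B₁ B₂) (pullbackMapW (Hom.inl A₁ A₂) x) = zeroW) ∧
        (pushoutMapW (Hom.fst B₁ B₂) (pullbackMapW (Hom.inr A₁ A₂) x) = zeroW ∧
          pushoutMapW (Hom.snd B₁ B₂) (pullbackMapW (Hom.inr A₁ A₂) x) = zeroW) := by
  rw [eq_iff_prodEquivFour, prodEquivFour_zeroW, prodEquivFour_apply, Prod.mk.injEq, Prod.mk.injEq,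
    Prod.mk.injEq]

/-! #### The direct sum of classes is the diagonal -/

/-- **`x₁ ⊕ x₂` is the diagonal matrix `((x₁, 0), (0, x₂))`.** [cite: MacLane1963Homology, Ch. III (2.3)] -/
@[simp]
theorem prodEquivFour_prodW (x₁ : Ext A₁ B₁) (x₂ : Ext A₂ B₂) :
    prodEquivFour A₁ A₂ B₁ B₂ (prodW x₁ x₂) = ((x₁, zeroW), (zeroW, x₂)) := by
  rw [prodEquivFour_apply, pushoutMapW_fst_pullbackMapW_inl_prodW, pushoutMapW_snd_pullbackMapW_inl_prodW,
    pushoutMapW_fst_pullbackMapW_inr_prodW, pushoutMapW_snd_pullbackMapW_inr_prodW]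

/-- `prodEquivFour⁻¹ ((x₁, 0), (0, x₂)) = x₁ ⊕ x₂`. [cite: MacLane1963Homology, Ch. III (2.3)] -/
theorem prodEquivFour_symm_diag (x₁ : Ext A₁ B₁) (x₂ : Ext A₂ B₂) :
    (prodEquivFour A₁ A₂ B₁ B₂).symm ((x₁, zeroW), (zeroW, x₂)) = prodW x₁ x₂ := by
  rw [Equiv.symm_apply_eq, prodEquivFour_prodW]

/-- `x = x₁ ⊕ x₂` iff the matrix of `x` is `((x₁, 0), (0, x₂))`. [cite: MacLane1963Homology, Ch. III (2.3)] -/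
theorem eq_prodW_iff (x : Ext (A₁.prod A₂) (B₁.prod B₂)) (x₁ : Ext A₁ B₁) (x₂ : Ext A₂ B₂) :
    x = prodW x₁ x₂ ↔ prodEquivFour A₁ A₂ B₁ B₂ x = ((x₁, zeroW), (zeroW, x₂)) := by
  rw [← prodEquivFour_prodW, (prodEquivFour A₁ A₂ B₁ B₂).injective.eq_iff]

/-- If `x` is a direct sum of classes, it is the direct sum of its DIAGONAL entries.
[cite: MacLane1963Homology, Ch. III (2.3)] -/
theorem eq_prodW_diag_of_offDiag_eq_zeroW (x : Ext (A₁.prod A₂) (B₁.prod B₂))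
    (h₁₂ : pushoutMapW (Hom.snd B₁ B₂) (pullbackMapW (Hom.inl A₁ A₂) x) = zeroW)
    (h₂₁ : pushoutMapW (Hom.fst B₁ B₂) (pullbackMapW (Hom.inr A₁ A₂) x) = zeroW) :
    x = prodW (pushoutMapW (Hom.fst B₁ B₂) (pullbackMapW (Hom.inl A₁ A₂) x))
      (pushoutMapW (Hom.snd B₁ B₂) (pullbackMapW (Hom.inr A₁ A₂) x)) := by
  rw [eq_prodW_iff, prodEquivFour_apply, h₁₂, h₂₁]

/-- **A class in `Ext(A₁ ⊕ A₂, B₁ ⊕ B₂)` is a direct sum `x₁ ⊕ x₂` of classes iff its off-diagonal entries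
`π₂_* ι₁^* x` and `π₁_* ι₂^* x` vanish.** [cite: MacLane1963Homology, Ch. III (2.3)] -/
theorem exists_eq_prodW_iff (x : Ext (A₁.prod A₂) (B₁.prod B₂)) :
    (∃ (x₁ : Ext A₁ B₁) (x₂ : Ext A₂ B₂), x = prodW x₁ x₂) ↔
      pushoutMapW (Hom.snd B₁ B₂) (pullbackMapW (Hom.inl A₁ A₂) x) = zeroW ∧
        pushoutMapW (Hom.fst B₁ B₂) (pullbackMapW (Hom.inr A₁ A₂) x) = zeroW := by
  constructor
  · rintro ⟨x₁, x₂, rfl⟩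
    exact ⟨pushoutMapW_snd_pullbackMapW_inl_prodW x₁ x₂, pushoutMapW_fst_pullbackMapW_inr_prodW x₁ x₂⟩
  · rintro ⟨h₁₂, h₂₁⟩
    exact ⟨_, _, eq_prodW_diag_of_offDiag_eq_zeroW x h₁₂ h₂₁⟩

/-! #### Compatibility with Brylinski–Zucker's invariant -/

/-- Under `extEquivJHomW` the four-fold decomposition of `Ext` is `JHomW.prodEquivFour` (entrywise).
[cite: BrylinskiZucker1998, Prop. 5.22] -/
theorem prodEquivFour_extEquivJHomW (x : Ext (A₁.prod A₂) (B₁.prod B₂)) :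
    JHomW.prodEquivFour A₁ A₂ B₁ B₂ (extEquivJHomW x) =
      ((extEquivJHomW (prodEquivFour A₁ A₂ B₁ B₂ x).1.1, extEquivJHomW (prodEquivFour A₁ A₂ B₁ B₂ x).1.2),
        (extEquivJHomW (prodEquivFour A₁ A₂ B₁ B₂ x).2.1, extEquivJHomW (prodEquivFour A₁ A₂ B₁ B₂ x).2.2)) := by
  rw [JHomW.prodEquivFour_apply, prodEquivFour_apply]
  simp only [extEquivJHomW_pushoutMapW, extEquivJHomW_pullbackMapW, ← extEquivJHomW_apply]

/-! #### Naturality -/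

variable {V₁' : Type u₁'} [AddCommGroup V₁'] [Module ℚ V₁'] {V₂' : Type u₂'} [AddCommGroup V₂'] [Module ℚ V₂']
variable {W₁' : Type v₁'} [AddCommGroup W₁'] [Module ℚ W₁'] {W₂' : Type v₂'} [AddCommGroup W₂'] [Module ℚ W₂']
variable {A₁' : MixedHodgeStructure V₁'} {A₂' : MixedHodgeStructure V₂'}
variable {B₁' : MixedHodgeStructure W₁'} {B₂' : MixedHodgeStructure W₂'}

/-- **Naturality in the quotients**: the matrix of `(f₁ ⊕ f₂)^* x` is `(f_i^* x_{ij})`.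
[cite: MacLane1963Homology, Ch. III Lemma 1.6] -/
theorem prodEquivFour_pullbackMapW_prodMap (f₁ : Hom A₁' A₁) (f₂ : Hom A₂' A₂)
    (x : Ext (A₁.prod A₂) (B₁.prod B₂)) :
    prodEquivFour A₁' A₂' B₁ B₂ (pullbackMapW (Hom.prodMap f₁ f₂) x) =
      ((pullbackMapW f₁ (prodEquivFour A₁ A₂ B₁ B₂ x).1.1, pullbackMapW f₁ (prodEquivFour A₁ A₂ B₁ B₂ x).1.2),
        (pullbackMapW f₂ (prodEquivFour A₁ A₂ B₁ B₂ x).2.1,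
          pullbackMapW f₂ (prodEquivFour A₁ A₂ B₁ B₂ x).2.2)) := by
  simp only [prodEquivFour_apply, pushoutMapW_pullbackMapW, ← pullbackMapW_comp, Hom.prodMap_comp_inl,
    Hom.prodMap_comp_inr]

/-- **Naturality in the subs**: the matrix of `(g₁ ⊕ g₂)_* x` is `(g_j_* x_{ij})`.
[cite: MacLane1963Homology, Ch. III Lemma 1.6] -/
theorem prodEquivFour_pushoutMapW_prodMap (g₁ : Hom B₁ B₁') (g₂ : Hom B₂ B₂')
    (x : Ext (A₁.prod A₂) (B₁.prod B₂)) :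
    prodEquivFour A₁ A₂ B₁' B₂' (pushoutMapW (Hom.prodMap g₁ g₂) x) =
      ((pushoutMapW g₁ (prodEquivFour A₁ A₂ B₁ B₂ x).1.1, pushoutMapW g₂ (prodEquivFour A₁ A₂ B₁ B₂ x).1.2),
        (pushoutMapW g₁ (prodEquivFour A₁ A₂ B₁ B₂ x).2.1,
          pushoutMapW g₂ (prodEquivFour A₁ A₂ B₁ B₂ x).2.2)) := by
  simp only [prodEquivFour_apply, ← pushoutMapW_pullbackMapW, ← pushoutMapW_comp, Hom.fst_comp_prodMap,
    Hom.snd_comp_prodMap]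

end Four

/-! ### §3 On extensions: the four corner extensions `π_j_* ι_i^* E` -/

section Extensions

variable {A₁ : MixedHodgeStructure V₁} {A₂ : MixedHodgeStructure V₂} {B₁ : MixedHodgeStructure W₁}
  {B₂ : MixedHodgeStructure W₂}
variable {VE : Type w} [AddCommGroup VE] [Module ℚ VE] {VE' : Type w'} [AddCommGroup VE'] [Module ℚ VE']

/-- **The matrix of `[E]` consists of the classes of the corner extensions `π_j_* ι_i^* E`.**
[cite: MacLane1963Homology, Ch. III Lemmas 1.2, 1.4] -/
theorem prodEquivFour_mkOfW (E : Extension (A₁.prod A₂) (B₁.prod B₂) VE) :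
    prodEquivFour A₁ A₂ B₁ B₂ (mkOfW E) =
      ((mkOfW ((E.pullback (Hom.inl A₁ A₂)).pushout (Hom.fst B₁ B₂)),
          mkOfW ((E.pullback (Hom.inl A₁ A₂)).pushout (Hom.snd B₁ B₂))),
        (mkOfW ((E.pullback (Hom.inr A₁ A₂)).pushout (Hom.fst B₁ B₂)),
          mkOfW ((E.pullback (Hom.inr A₁ A₂)).pushout (Hom.snd B₁ B₂)))) := by
  simp only [prodEquivFour_apply, pullbackMapW_mkOfW, pushoutMapW_mkOfW]

/-- **The matrix of `[E₁ ⊕ E₂]` is `(([E₁], 0), (0, [E₂]))`.** [cite: MacLane1963Homology, Ch. III (2.3)] -/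
theorem prodEquivFour_mkOfW_prod (E₁ : Extension A₁ B₁ VE) (E₂ : Extension A₂ B₂ VE') :
    prodEquivFour A₁ A₂ B₁ B₂ (mkOfW (E₁.prod E₂)) = ((mkOfW E₁, zeroW), (zeroW, mkOfW E₂)) := by
  rw [← prodW_mkOfW, prodEquivFour_prodW]

end Extensions

end Ext

namespace Extension

variable {A₁ : MixedHodgeStructure V₁} {A₂ : MixedHodgeStructure V₂} {B₁ : MixedHodgeStructure W₁}
  {B₂ : MixedHodgeStructure W₂}
variable {VE : Type w} [AddCommGroup VE] [Module ℚ VE]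

/-- **`E` splits iff its four corner extensions `π_j_* ι_i^* E` split.** [cite: MacLane1963Homology, Ch. III Thm. 2.1] -/
theorem isSplit_iff_corners (E : Extension (A₁.prod A₂) (B₁.prod B₂) VE) :
    E.IsSplit ↔
      (((E.pullback (Hom.inl A₁ A₂)).pushout (Hom.fst B₁ B₂)).IsSplit ∧
          ((E.pullback (Hom.inl A₁ A₂)).pushout (Hom.snd B₁ B₂)).IsSplit) ∧
        (((E.pullback (Hom.inr A₁ A₂)).pushout (Hom.fst B₁ B₂)).IsSplit ∧
          ((E.pullback (Hom.inr A₁ A₂)).pushout (Hom.snd B₁ B₂)).IsSplit) := by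
  rw [← Ext.mkOfW_eq_zeroW_iff, Ext.eq_zeroW_iff_prodEquivFour]
  simp only [Ext.pullbackMapW_mkOfW, Ext.pushoutMapW_mkOfW, Ext.mkOfW_eq_zeroW_iff]

/-- **An extension of `A₁ ⊕ A₂` by `B₁ ⊕ B₂` is congruent to the direct sum of its diagonal corners
`π₁_* ι₁^* E ⊕ π₂_* ι₂^* E` iff its off-diagonal corners `π₂_* ι₁^* E`, `π₁_* ι₂^* E` split.**
[cite: MacLane1963Homology, Ch. III (2.3)] -/
theorem nonempty_congruence_prod_corners_iff (E : Extension (A₁.prod A₂) (B₁.prod B₂) VE) :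
    Nonempty (Congruence E
        (((E.pullback (Hom.inl A₁ A₂)).pushout (Hom.fst B₁ B₂)).prod
          ((E.pullback (Hom.inr A₁ A₂)).pushout (Hom.snd B₁ B₂)))) ↔
      ((E.pullback (Hom.inl A₁ A₂)).pushout (Hom.snd B₁ B₂)).IsSplit ∧
        ((E.pullback (Hom.inr A₁ A₂)).pushout (Hom.fst B₁ B₂)).IsSplit := by
  rw [← Ext.mkOfW_eq_mkOfW_iff, ← Ext.prodW_mkOfW, Ext.eq_prodW_iff, Ext.prodEquivFour_mkOfW, Prod.mk.injEq,
    Prod.mk.injEq, Prod.mk.injEq, Ext.mkOfW_eq_zeroW_iff, Ext.mkOfW_eq_zeroW_iff]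
  simp only [true_and, and_true]

/-- If the off-diagonal corners split, `E ≡ π₁_* ι₁^* E ⊕ π₂_* ι₂^* E`. [cite: MacLane1963Homology, Ch. III (2.3)] -/
theorem nonempty_congruence_prod_corners (E : Extension (A₁.prod A₂) (B₁.prod B₂) VE)
    (h₁₂ : ((E.pullback (Hom.inl A₁ A₂)).pushout (Hom.snd B₁ B₂)).IsSplit)
    (h₂₁ : ((E.pullback (Hom.inr A₁ A₂)).pushout (Hom.fst B₁ B₂)).IsSplit) :
    Nonempty (Congruence E
        (((E.pullback (Hom.inl A₁ A₂)).pushout (Hom.fst B₁ B₂)).prod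
          ((E.pullback (Hom.inr A₁ A₂)).pushout (Hom.snd B₁ B₂)))) :=
  (nonempty_congruence_prod_corners_iff E).2 ⟨h₁₂, h₂₁⟩

end Extension

end MixedHodgeStructure

end Literature.AlgebraicGeometry.Motives

end
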